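import Literature.AnabelianGeometry.SemiGraphs.FiniteEtaleCoveringAlignedLift
import Literature.AnabelianGeometry.SemiGraphs.CoveringComparison
import Literature.AnabelianGeometry.SemiGraphs.CoveringEssSurjIso
import Literature.AnabelianGeometry.SemiGraphs.CoveringStarIso
import Literature.AnabelianGeometry.SemiGraphs.FibredSemiGraph

/-!
# Aligned local data of print's constructed covering `𝒢_A → 𝒢` ([SemiAnbd] §2, Def. 2.2 (i))

Mochizuki, *Semi-graphs of anabelioids*, Publ. RIMS **42** (2006) 221–322, §2, Definition 2.2 (i),
author's manuscript p. 23 [cite: MochizukiSemiAnbd2006, Def. 2.2(i) p.23]: the finite étale covering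
attached to `A = G' ∈ B(𝒢)` is CONSTRUCTED (`BObj.coveringGraph`, `BObj.coveringHomCan`; global clause
`B(𝒢_A) ≃ B(𝒢)_{/A}` through the comparison functor `BObj.toCovering`).

abc-iut cell, layer L3, row «COMP-LOCAL» (J0): print's construction carries ALIGNED LOCAL DATA in the
sense of `Hom.AlignedLocalData` (`FiniteEtaleCoveringAlignedLift.lean`) — the `Shrink` models of the
component anabelioids as local equivalences with identity compatibilities, and the unit of the model
equivalence as functor-level branch alignment — and its lift IS the comparison functor:

* `BObj.alignedLocalDataCan A : (A.coveringHomCan).AlignedLocalData A`;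
* `BObj.alignedLocalDataCanLiftIso : (A.alignedLocalDataCan).lift ≅ A.toCovering` (identity on
  vertex/edge objects; the gluings agree because both are the canonical pull-back comparison);
* hence `lift` is an equivalence and `(coveringHomCan A)^* ≅ (A × −) ⋙ lift`
  (`alignedLocalDataCan_lift_isEquivalence`, `coveringHomCan_pullbackFunctor_iso_star_lift`) — the
  junction hypothesis of `FiniteEtaleCoveringCompLocal.lean` HOLDS for print's construction.

One `def` of data (the structure instance) and one canonical natural isomorphism; no `Prop` fact, no
instance, no notation.  Nothing here takes a side on [IUTchIII] Cor. 3.12.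
-/

namespace Literature.AnabelianGeometry.SemiGraphs

open CategoryTheory CategoryTheory.Limits CategoryTheory.PreGaloisCategory
open Literature.AnabelianGeometry.Anabelioids

universe v₁ u₁ u

-- Mathlib's `Over.pullback` / `Over.post` simp lemmas only fire under the pre-v4.2x defeq transparency
-- behaviour, exactly as in `Mathlib/CategoryTheory/Comma/Over/Pullback.lean` (also: `π₀Obj` coercions).
set_option backward.isDefEq.respectTransparency false

namespace SemiGraphOfAnabelioids

namespace BObj

variable {𝒢 : SemiGraphOfAnabelioids.{v₁, u₁, u}} (A : 𝒢.BObj)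

/-- The edge label of print's construction at a presentation `proj (edgeOf?) = e₀` of the image edge
(transport of `eComp`). [cite: MochizukiSemiAnbd2006, Def. 2.2(i) p.23] -/
noncomputable def eCompAt (ec : A.fibreData.total.Edge) (e₀ : 𝒢.graph.Edge)
    (p : A.fibreData.proj.edgeMap ec = e₀) : π₀Obj (A.T e₀) :=
  Eq.mpr (congrArg (fun e => π₀Obj (A.T e)) p.symm) (A.eComp ec)

/-- At the canonical presentation `eCompAt` is `eComp`. [cite: MochizukiSemiAnbd2006, Def. 2.2(i) p.23] -/
@[simp] theorem eCompAt_rfl (ec : A.fibreData.total.Edge) :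
    A.eCompAt ec (A.fibreData.proj.edgeMap ec) rfl = A.eComp ec := rfl

/-- At the presentation by the edge of a branch, `eCompAt` is `brComp` (the projection of the fibred
semi-graph commutes with `edgeOf` definitionally). [cite: MochizukiSemiAnbd2006, Def. 2.2(i) p.23] -/
theorem eCompAt_edgeOf (bc : A.fibreData.total.Branch) :
    A.eCompAt (A.fibreData.total.edgeOf bc) (𝒢.graph.edgeOf (A.fibreData.proj.branchMap bc))
      (A.fibreData.proj.edgeOf_branchMap bc).symm = A.brComp bc := rfl

/-- The model equivalence `Over Q ⥤ (𝒢_A)_{ec}` at a presentation of the image edge (transport of `toE`).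
[cite: MochizukiSemiAnbd2006, Def. 2.2(i) p.23] -/
noncomputable def toEAt (ec : A.fibreData.total.Edge) (e₀ : 𝒢.graph.Edge)
    (p : A.fibreData.proj.edgeMap ec = e₀) : Over ((A.eCompAt ec e₀ p).1 : 𝒢.E e₀) ⥤ A.EModel ec := by
  subst p
  exact A.toE ec

/-- At the canonical presentation `toEAt` is `toE`. [cite: MochizukiSemiAnbd2006, Def. 2.2(i) p.23] -/
@[simp] theorem toEAt_rfl (ec : A.fibreData.total.Edge) :
    A.toEAt ec (A.fibreData.proj.edgeMap ec) rfl = A.toE ec := rfl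

/-- At the presentation by the edge of a branch, `toEAt` is `toBr`. [cite: MochizukiSemiAnbd2006, Def. 2.2(i) p.23] -/
theorem toEAt_edgeOf (bc : A.fibreData.total.Branch) :
    A.toEAt (A.fibreData.total.edgeOf bc) (𝒢.graph.edgeOf (A.fibreData.proj.branchMap bc))
      (A.fibreData.proj.edgeOf_branchMap bc).symm = A.toBr bc := rfl

/-- `toEAt` is an equivalence. [cite: MochizukiSemiAnbd2006, Def. 2.2(i) p.23] -/
theorem toEAt_isEquivalence (ec : A.fibreData.total.Edge) (e₀ : 𝒢.graph.Edge)
    (p : A.fibreData.proj.edgeMap ec = e₀) : (A.toEAt ec e₀ p).IsEquivalence := by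
  subst p
  exact (Shrink.equivalence (Over ((A.eComp ec).1 : 𝒢.E (A.fibreData.proj.edgeMap ec)))).isEquivalence_functor

/-- `(edgeHomAt ec e₀ p)^* = (Q × −) ⋙ toEAt` (both sides transport the canonical presentation).
[cite: MochizukiSemiAnbd2006, Def. 2.2(i) p.23] -/
theorem edgeHomAt_pullback_eq (ec : A.fibreData.total.Edge) (e₀ : 𝒢.graph.Edge)
    (p : A.fibreData.proj.edgeMap ec = e₀) :
    (A.edgeHomAt ec e₀ p).pullback = Over.star ((A.eCompAt ec e₀ p).1 : 𝒢.E e₀) ⋙ A.toEAt ec e₀ p := by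
  subst p
  rfl

/-- **Print's constructed covering carries aligned local data** over `A`: labels `vComp`/`eComp`, local
equivalences the `Shrink` models with identity compatibilities (`Iso.refl`, as in
`coveringHomCan_isFiniteEtaleCoveringOf`), `le_branchImage` = `brComp_le_branchImage`, and branch
alignment `β` = the unit of the vertex model whiskered with the gluing functor
(`coveringGraph_pull_pullback`). [cite: MochizukiSemiAnbd2006, Def. 2.2(i) p.23] -/
noncomputable def alignedLocalDataCan : (A.coveringHomCan).AlignedLocalData A where
  cV vc := A.vComp vc
  cE ec e₀ p := A.eCompAt ec e₀ p
  cV_bijective := by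
    constructor
    · rintro ⟨v, c⟩ ⟨v', c'⟩ hvc
      change (⟨v, A.vComp ⟨v, c⟩⟩ : Σ w, π₀Obj (A.S w)) = ⟨v', A.vComp ⟨v', c'⟩⟩ at hvc
      obtain ⟨rfl, h2⟩ := Sigma.mk.inj_iff.mp hvc
      obtain rfl : c = c' := (equivShrink _).symm.injective (eq_of_heq h2)
      rfl
    · rintro ⟨v, P⟩
      exact ⟨⟨v, equivShrink _ P⟩, Sigma.ext rfl (heq_of_eq (Equiv.symm_apply_apply _ _))⟩
  cE_bijective := by
    constructor
    · rintro ⟨e, c⟩ ⟨e', c'⟩ hec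
      change (⟨e, A.eComp ⟨e, c⟩⟩ : Σ f, π₀Obj (A.T f)) = ⟨e', A.eComp ⟨e', c'⟩⟩ at hec
      obtain ⟨rfl, h2⟩ := Sigma.mk.inj_iff.mp hec
      obtain rfl : c = c' := (equivShrink _).symm.injective (eq_of_heq h2)
      rfl
    · rintro ⟨e, Q⟩
      exact ⟨⟨e, equivShrink _ Q⟩, Sigma.ext rfl (heq_of_eq (Equiv.symm_apply_apply _ _))⟩
  αV vc := A.toV vc
  αV_isEquivalence vc :=
    (Shrink.equivalence (Over ((A.vComp vc).1 : 𝒢.V (A.fibreData.proj.vertexMap vc)))).isEquivalence_functor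
  εV vc := Iso.refl _
  αE ec e₀ p := A.toEAt ec e₀ p
  αE_isEquivalence ec e₀ p := A.toEAt_isEquivalence ec e₀ p
  εE ec e₀ p := eqToIso (A.edgeHomAt_pullback_eq ec e₀ p)
  le_branchImage bc vc h := brComp_le_branchImage h
  β bc vc h :=
    show A.toV vc ⋙ (A.fromV vc ⋙ A.gluingAt bc vc h ⋙ A.toBr bc) ≅ A.gluingAt bc vc h ⋙ A.toBr bc from
      (Functor.associator _ _ _).symm ≪≫
        Functor.isoWhiskerRight
          (Shrink.equivalence (Over ((A.vComp vc).1 : 𝒢.V (A.fibreData.proj.vertexMap vc)))).unitIso.symm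
          (A.gluingAt bc vc h ⋙ A.toBr bc) ≪≫ Functor.leftUnitor _

/-- The vertex pieces of the aligned data are the vertex components of the comparison functor.
[cite: MochizukiSemiAnbd2006, Def. 2.2(i) p.23] -/
theorem alignedLocalDataCan_pieceV (vc : A.fibreData.total.Vertex) :
    (A.alignedLocalDataCan).pieceV vc = A.toCoveringV vc := rfl

/-- The edge pieces (canonical presentation) are the edge components of the comparison functor.
[cite: MochizukiSemiAnbd2006, Def. 2.2(i) p.23] -/
theorem alignedLocalDataCan_pieceE (ec : A.fibreData.total.Edge) :
    (A.alignedLocalDataCan).pieceE ec _ rfl = A.toCoveringE ec := rfl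

/-- The gluing isomorphisms of the aligned data and of the comparison functor coincide (both are THE
pull-back comparison of the gluing square). [cite: MochizukiSemiAnbd2006, Def. 2.2(i) p.23] -/
theorem alignedLocalDataCan_glueApp_hom (bc : A.fibreData.total.Branch) (vc : A.fibreData.total.Vertex)
    (h : A.fibreData.total.abuts bc = some vc) (X : Over A) :
    ((A.alignedLocalDataCan).glueApp bc vc h X).hom = (A.toCoveringGlueApp bc vc h X).hom := by
  ext
  apply pullback.hom_ext
  · rw [Hom.AlignedLocalData.glueApp_hom_left_fst]
    erw [toCoveringGlueApp_hom_left_fst]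
    rfl
  · rw [Hom.AlignedLocalData.glueApp_hom_left_snd]
    erw [toCoveringGlueApp_hom_left_snd]
    rfl

/-- The branch alignment of print's aligned data, componentwise: the model of the gluing functor applied
to the unit of the vertex model. [cite: MochizukiSemiAnbd2006, Def. 2.2(i) p.23] -/
theorem alignedLocalDataCan_β_hom_app (bc : A.fibreData.total.Branch) (vc : A.fibreData.total.Vertex)
    (h : A.fibreData.total.abuts bc = some vc)
    (Y : Over ((A.vComp vc).1 : 𝒢.V (A.fibreData.proj.vertexMap vc))) :
    ((A.alignedLocalDataCan).β bc vc h).hom.app Y =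
      (A.toBr bc).map ((A.gluingAt bc vc h).map
        ((Shrink.equivalence (Over ((A.vComp vc).1 : 𝒢.V (A.fibreData.proj.vertexMap vc)))).unitIso.inv.app
          Y)) := by
  change ((Functor.associator _ _ _).symm ≪≫
      Functor.isoWhiskerRight
        (Shrink.equivalence (Over ((A.vComp vc).1 : 𝒢.V (A.fibreData.proj.vertexMap vc)))).unitIso.symm
        (A.gluingAt bc vc h ⋙ A.toBr bc) ≪≫ Functor.leftUnitor _).hom.app Y = _
  simp only [Iso.trans_hom, NatTrans.comp_app, Iso.symm_hom, Functor.associator_inv_app,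
    Functor.isoWhiskerRight_hom, Functor.whiskerRight_app, Functor.leftUnitor_hom_app, Functor.comp_map]
  erw [Category.id_comp, Category.comp_id]

/-- **The lift of print's aligned data is the comparison functor `B(𝒢)_{/A} ⥤ B(𝒢_A)`** — identity on
vertex and edge objects; the gluing of the lift along `(b, Q)` at `(v, P)` is the unit of the vertex
model, then the model of the gluing square, then a trivial re-presentation, i.e. the gluing of
`toCovering`. [cite: MochizukiSemiAnbd2006, Def. 2.2(i) p.23] -/
noncomputable def alignedLocalDataCanLiftIso : (A.alignedLocalDataCan).lift ≅ A.toCovering := by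
  refine BObj.natIsoOfComponents (F := (A.alignedLocalDataCan).lift) (G := A.toCovering)
    (fun vc => Iso.refl _) (fun ec => Iso.refl _) ?_
  intro bc vc h X
  rw [Iso.refl_hom, NatTrans.id_app, Iso.refl_hom, NatTrans.id_app]
  erw [CategoryTheory.Functor.map_id, Category.id_comp, Category.comp_id]
  change (((A.liftOver A.toCoveringV A.toCoveringE (fun bc vc h => A.toCoveringGlue bc vc h)).obj X).ψ
      bc vc h).hom = (((A.alignedLocalDataCan).lift.obj X).ψ bc vc h).hom
  rw [Hom.AlignedLocalData.lift_obj_ψ_hom, alignedLocalDataCan_glueApp_hom, liftOver_obj_ψ_hom,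
    alignedLocalDataCan_β_hom_app, eqToIso.hom, eqToHom_app]
  erw [eqToHom_refl, Category.comp_id]
  rfl

/-- The lift of print's aligned data is an equivalence. [cite: MochizukiSemiAnbd2006, Def. 2.2(i) p.23] -/
theorem alignedLocalDataCan_lift_isEquivalence : (A.alignedLocalDataCan).lift.IsEquivalence :=
  haveI := A.toCovering_isEquivalence
  Functor.isEquivalence_of_iso A.alignedLocalDataCanLiftIso.symm

/-- `(coveringHomCan A)^* ≅ (A × −) ⋙ lift` — the pull-back functor of print's covering factors through
the lift of its aligned data (via `pullbackFunctorIsoStarComp`). [cite: MochizukiSemiAnbd2006, Def. 2.2(i) p.23] -/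
noncomputable def coveringHomCan_pullbackFunctor_iso_star_lift [HasBinaryProducts 𝒢.BObj] :
    A.coveringHomCan.pullbackFunctor ≅ Over.star A ⋙ (A.alignedLocalDataCan).lift :=
  A.pullbackFunctorIsoStarComp ≪≫ Functor.isoWhiskerLeft _ A.alignedLocalDataCanLiftIso.symm

end BObj

end SemiGraphOfAnabelioids

end Literature.AnabelianGeometry.SemiGraphs
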